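import Summits.ResolutionOfSingularities.ResolutionOfSingularities.Theorems.PurelyInseparableDim4UniformNoReply
import HarnessLib

/-!
# [OURS · res-dim4-pi · F4-C-loc] LOOP-C's LOCAL ESCAPE HOLDS OVER EVERY FIELD OF CHARACTERISTIC 3 — all replies,
  not only the `𝔽₃`-rational ones

Cell `res-dim4-pi` (D-0157 DOOR 2, wave 2), seat `res-dim4-p-6` g2; lifts the rider «`𝔽₃`-rational replies only»
off `LoopCLocal.loopC_localWins` (p663219, `decide` over `ZMod 3`) with the symbolic tool `UniformNoReply`
(maximal witnesses + single sources).  For a field `L` of characteristic `3` the six LOOP-C states of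
res-dim4-p-8 g2 (`LoopC.t0 … t5`, p662411) are base-changed along `𝔽₃ → L` (`liftState`).

* §1 the certificates (all by `decide +kernel` on the `𝔽₃` data): MAXIMAL WITNESSES for the blow-up of the unique
  component at `t1` (`x₄²` in the `x₂`-chart, `x₂` in the `x₄`-chart), `t2` (`x₄²` / `x₁`), `t4` (`x₃²` / `x₂`),
  `t5` (`x₃²` / `x₁`), and for the `x₄`- resp. `x₃`-chart of `V(x₁,x₄)` at `t0` / `V(x₁,x₃)` at `t3` (`x₄` / `x₃`);
  SINGLE SOURCES for the `x₁`-charts at `t0` / `t3` (`x₂` is produced only by `x₂x₄²` resp. `x₂x₃²`, coefficient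
  `β²` in the fibre coordinate `β`).
* §2 **over every field `L` of characteristic 3 and EVERY `L`-point over the current point**:
  `no_local_reply_t1/t2/t4/t5` (no equimultiple reply at all to the forced component), `no_local_reply_t0_x4`,
  `local_reply_t0_x1_eq_zero` (equimultiple in the `x₁`-chart ⇒ `β² = 0` ⇒ the reply is the chart origin), the
  mirror statements at `t3`, and `step_origin_t0/t3` (the origin replies land on `t1`, `t4` lifted).
* §3 **`rWins_t1/t2/t4/t5`, `rWins_t0/t3`, `loopC_localWins_allFields`**: for EVERY field `L` with `CharP L 3`,
  every base-changed LOOP-C state is an A-win of the LOCAL in-scope game (`LoopCLocal.RWins 3 localB`), A playing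
  the maximal-dimensional components — the kernel form of crit-4 V-A-4-12 / crit-5 T-A5-01 «no `3`-fold point in
  the fibre even over `𝔽̄₃`» for these states and centres.

Scope (honest): the LOCAL game only (B confined to the current point); the six literal states; GLOBAL hops are where
LOOP-C lives (p662411).  [OURS · counted 0 · kernel certificates + symbolic coefficient law; AI kernel work, weaker
than expert review.]  NOTHING here is a statement about resolution of singularities; resolution in dimension `≥ 4` /
characteristic `p > 0` is NOT proved by anything in this file.  bears_on: LADDER-RESOLUTION:D157-DOOR2 (res-dim4-pi ·
F4-C-loc(3,3) all fields · C-LOOP-C).  Host item (DR-157-C): `stmt-ResolutionOfSingularities-16155`, helper.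
-/

set_option linter.dupNamespace false -- mandated namespace of this single-conjunct summit

noncomputable section

open MvPolynomial Finset
open scoped BigOperators

namespace Summit.ResolutionOfSingularities.ResolutionOfSingularities.Theorems.PIDim4

namespace LoopCLocal

open Literature.AlgebraicGeometry.Resolution
open Literature.AlgebraicGeometry.Resolution.CentreBlowup
open StepKit LoopC UniformNoReply

/-! ## §0 Base change `𝔽₃ → L` -/

section Lift

variable (L : Type) [Field L] [CharP L 3]

/-- the structure map `𝔽₃ → L` of a field of characteristic `3`. [folklore] -/
def φ3 : ZMod 3 →+* L := ZMod.castHom (dvd_refl 3) L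

/-- a state over `𝔽₃`, base-changed to `L` (same decorations). OURS. [folklore] -/
def liftState (s : State (ZMod 3)) : State L := ⟨MvPolynomial.map (φ3 L) s.F, s.r, s.exc⟩

/-- for presented states the lift is the literal of `UniformNoReply`. OURS. [folklore] -/
theorem liftState_toState (s : SData 4 (ZMod 3)) :
    liftState L s.toState = ⟨MvPolynomial.map (φ3 L) s.toState.F, s.toState.r, s.toState.exc⟩ := rfl

omit [CharP L 3] in
/-- off the centre `S` and at the chart coordinate `j` a local reply vanishes; packaged for `T = S.erase j`.
OURS. [folklore] -/
theorem vanish_erase {S : Finset (Fin 4)} {j : Fin 4} {b : Fin 4 → L} (hbj : b j = 0)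
    (hb : ∀ m : Fin 4, m ∉ S → b m = 0) : ∀ m : Fin 4, m ∉ S.erase j → b m = 0 := by
  intro m hm
  by_cases hmj : m = j
  · rw [hmj]; exact hbj
  · exact hb m fun hmS => hm (Finset.mem_erase.mpr ⟨hmj, hmS⟩)

end Lift

/-! ## §1 The certificates over `𝔽₃` -/

/-- `t1`, centre `V(x₂,x₄)`, `x₂`-chart: maximal witness `x₄²`. [OURS · ‖ K] -/
theorem w_t1_x2 : uniformWitnessB 3 {1, 3} 1 (({1, 3} : Finset (Fin 4)).erase 1) t1.L ![0, 0, 0, 2] = true := by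
  decide +kernel
/-- `t1`, `x₄`-chart: maximal witness `x₂`. [OURS · ‖ K] -/
theorem w_t1_x4 : uniformWitnessB 3 {1, 3} 3 (({1, 3} : Finset (Fin 4)).erase 3) t1.L ![0, 1, 0, 0] = true := by
  decide +kernel
/-- `t2`, centre `V(x₁,x₄)`, `x₁`-chart: maximal witness `x₄²`. [OURS · ‖ K] -/
theorem w_t2_x1 : uniformWitnessB 3 {0, 3} 0 (({0, 3} : Finset (Fin 4)).erase 0) t2.L ![0, 0, 0, 2] = true := by
  decide +kernel
/-- `t2`, `x₄`-chart: maximal witness `x₁`. [OURS · ‖ K] -/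
theorem w_t2_x4 : uniformWitnessB 3 {0, 3} 3 (({0, 3} : Finset (Fin 4)).erase 3) t2.L ![1, 0, 0, 0] = true := by
  decide +kernel
/-- `t4`, centre `V(x₂,x₃)`, `x₂`-chart: maximal witness `x₃²`. [OURS · ‖ K] -/
theorem w_t4_x2 : uniformWitnessB 3 {1, 2} 1 (({1, 2} : Finset (Fin 4)).erase 1) t4.L ![0, 0, 2, 0] = true := by
  decide +kernel
/-- `t4`, `x₃`-chart: maximal witness `x₂`. [OURS · ‖ K] -/
theorem w_t4_x3 : uniformWitnessB 3 {1, 2} 2 (({1, 2} : Finset (Fin 4)).erase 2) t4.L ![0, 1, 0, 0] = true := by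
  decide +kernel
/-- `t5`, centre `V(x₁,x₃)`, `x₁`-chart: maximal witness `x₃²`. [OURS · ‖ K] -/
theorem w_t5_x1 : uniformWitnessB 3 {0, 2} 0 (({0, 2} : Finset (Fin 4)).erase 0) t5.L ![0, 0, 2, 0] = true := by
  decide +kernel
/-- `t5`, `x₃`-chart: maximal witness `x₁`. [OURS · ‖ K] -/
theorem w_t5_x3 : uniformWitnessB 3 {0, 2} 2 (({0, 2} : Finset (Fin 4)).erase 2) t5.L ![1, 0, 0, 0] = true := by
  decide +kernel
/-- `t0`, centre `V(x₁,x₄)`, `x₄`-chart: maximal witness `x₄`. [OURS · ‖ K] -/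
theorem w_t0_x4 : uniformWitnessB 3 {0, 3} 3 (({0, 3} : Finset (Fin 4)).erase 3) t0.L ![0, 0, 0, 1] = true := by
  decide +kernel
/-- `t0`, centre `V(x₁,x₄)`, `x₁`-chart: `x₂` has the single source `x₂x₄²` (coefficient `1`). [OURS · ‖ K] -/
theorem ss_t0_x1 :
    singleSourceB 3 {0, 3} 0 (({0, 3} : Finset (Fin 4)).erase 0) t0.L ![0, 1, 0, 0] ![0, 1, 0, 2] = true := by
  decide +kernel
/-- `t3`, centre `V(x₁,x₃)`, `x₃`-chart: maximal witness `x₃`. [OURS · ‖ K] -/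
theorem w_t3_x3 : uniformWitnessB 3 {0, 2} 2 (({0, 2} : Finset (Fin 4)).erase 2) t3.L ![0, 0, 1, 0] = true := by
  decide +kernel
/-- `t3`, centre `V(x₁,x₃)`, `x₁`-chart: `x₂` has the single source `x₂x₃²`. [OURS · ‖ K] -/
theorem ss_t3_x1 :
    singleSourceB 3 {0, 2} 0 (({0, 2} : Finset (Fin 4)).erase 0) t3.L ![0, 1, 0, 0] ![0, 1, 2, 0] = true := by
  decide +kernel

/-! ## §2 No local reply / only the origin — over every field of characteristic 3 -/

section AllFields

variable (L : Type) [Field L] [CharP L 3]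

/-- membership in a two-element centre. [folklore] -/
theorem mem_pair {a c j : Fin 4} (h : j ∈ ({a, c} : Finset (Fin 4))) : j = a ∨ j = c := by
  simpa [Finset.mem_insert, Finset.mem_singleton] using h

/-- **`t1` over `L`: no equimultiple reply to `V(x₂,x₄)` at any `L`-point over the current point.** [OURS · ‖ K] -/
theorem no_local_reply_t1_allFields {j : Fin 4} (hj : j ∈ ({1, 3} : Finset (Fin 4))) {b : Fin 4 → L}
    (hbj : b j = 0) (hb : ∀ m : Fin 4, m ∉ ({1, 3} : Finset (Fin 4)) → b m = 0) :
    ¬ IsEquimultiplePoint 3 {1, 3} j b (liftState L t1.toState) := by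
  rcases mem_pair hj with rfl | rfl
  · exact not_isEquimultiplePoint_of_uniformWitnessB (φ3 L) w_t1_x2 (vanish_erase L hbj hb)
  · exact not_isEquimultiplePoint_of_uniformWitnessB (φ3 L) w_t1_x4 (vanish_erase L hbj hb)

/-- **`t2` (= `s2`) over `L`: no equimultiple reply to `V(x₁,x₄)` over the current point.** [OURS · ‖ K] -/
theorem no_local_reply_t2_allFields {j : Fin 4} (hj : j ∈ ({0, 3} : Finset (Fin 4))) {b : Fin 4 → L}
    (hbj : b j = 0) (hb : ∀ m : Fin 4, m ∉ ({0, 3} : Finset (Fin 4)) → b m = 0) :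
    ¬ IsEquimultiplePoint 3 {0, 3} j b (liftState L t2.toState) := by
  rcases mem_pair hj with rfl | rfl
  · exact not_isEquimultiplePoint_of_uniformWitnessB (φ3 L) w_t2_x1 (vanish_erase L hbj hb)
  · exact not_isEquimultiplePoint_of_uniformWitnessB (φ3 L) w_t2_x4 (vanish_erase L hbj hb)

/-- **`t4` over `L`: no equimultiple reply to `V(x₂,x₃)` over the current point.** [OURS · ‖ K] -/
theorem no_local_reply_t4_allFields {j : Fin 4} (hj : j ∈ ({1, 2} : Finset (Fin 4))) {b : Fin 4 → L}
    (hbj : b j = 0) (hb : ∀ m : Fin 4, m ∉ ({1, 2} : Finset (Fin 4)) → b m = 0) :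
    ¬ IsEquimultiplePoint 3 {1, 2} j b (liftState L t4.toState) := by
  rcases mem_pair hj with rfl | rfl
  · exact not_isEquimultiplePoint_of_uniformWitnessB (φ3 L) w_t4_x2 (vanish_erase L hbj hb)
  · exact not_isEquimultiplePoint_of_uniformWitnessB (φ3 L) w_t4_x3 (vanish_erase L hbj hb)

/-- **`t5` (= `s4`) over `L`: no equimultiple reply to `V(x₁,x₃)` over the current point.** [OURS · ‖ K] -/
theorem no_local_reply_t5_allFields {j : Fin 4} (hj : j ∈ ({0, 2} : Finset (Fin 4))) {b : Fin 4 → L}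
    (hbj : b j = 0) (hb : ∀ m : Fin 4, m ∉ ({0, 2} : Finset (Fin 4)) → b m = 0) :
    ¬ IsEquimultiplePoint 3 {0, 2} j b (liftState L t5.toState) := by
  rcases mem_pair hj with rfl | rfl
  · exact not_isEquimultiplePoint_of_uniformWitnessB (φ3 L) w_t5_x1 (vanish_erase L hbj hb)
  · exact not_isEquimultiplePoint_of_uniformWitnessB (φ3 L) w_t5_x3 (vanish_erase L hbj hb)

/-- **`t0` (= `s1`), `x₄`-chart of `V(x₁,x₄)`: no equimultiple `L`-point over the current point.** [OURS · ‖ K] -/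
theorem no_local_reply_t0_x4_allFields {b : Fin 4 → L} (hbj : b 3 = 0)
    (hb : ∀ m : Fin 4, m ∉ ({0, 3} : Finset (Fin 4)) → b m = 0) :
    ¬ IsEquimultiplePoint 3 {0, 3} 3 b (liftState L t0.toState) :=
  not_isEquimultiplePoint_of_uniformWitnessB (φ3 L) w_t0_x4 (vanish_erase L hbj hb)

/-- **`t0`, `x₁`-chart of `V(x₁,x₄)`: an equimultiple `L`-point over the current point IS the chart origin** (the
`x₂`-coefficient of the point transform is `β²`, `β` the fibre coordinate). [OURS · ‖ K] -/
theorem local_reply_t0_x1_eq_zero_allFields {b : Fin 4 → L} (hbj : b 0 = 0)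
    (hb : ∀ m : Fin 4, m ∉ ({0, 3} : Finset (Fin 4)) → b m = 0)
    (heq : IsEquimultiplePoint 3 {0, 3} 0 b (liftState L t0.toState)) : b = 0 := by
  have hprod := prod_eq_zero_of_isEquimultiplePoint_of_singleSourceB (φ3 L) ss_t0_x1 (vanish_erase L hbj hb) heq
  have h3 : b 3 = 0 := by
    simp [Fin.prod_univ_four] at hprod
    exact hprod
  funext i
  fin_cases i
  · exact hbj
  · exact hb 1 (by decide)
  · exact hb 2 (by decide)
  · exact h3

/-- **`t3` (= `s3`), `x₃`-chart of `V(x₁,x₃)`: no equimultiple `L`-point over the current point.** [OURS · ‖ K] -/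
theorem no_local_reply_t3_x3_allFields {b : Fin 4 → L} (hbj : b 2 = 0)
    (hb : ∀ m : Fin 4, m ∉ ({0, 2} : Finset (Fin 4)) → b m = 0) :
    ¬ IsEquimultiplePoint 3 {0, 2} 2 b (liftState L t3.toState) :=
  not_isEquimultiplePoint_of_uniformWitnessB (φ3 L) w_t3_x3 (vanish_erase L hbj hb)

/-- **`t3`, `x₁`-chart of `V(x₁,x₃)`: an equimultiple `L`-point over the current point is the chart origin**
(`x₂`-coefficient `β²`). [OURS · ‖ K] -/
theorem local_reply_t3_x1_eq_zero_allFields {b : Fin 4 → L} (hbj : b 0 = 0)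
    (hb : ∀ m : Fin 4, m ∉ ({0, 2} : Finset (Fin 4)) → b m = 0)
    (heq : IsEquimultiplePoint 3 {0, 2} 0 b (liftState L t3.toState)) : b = 0 := by
  have hprod := prod_eq_zero_of_isEquimultiplePoint_of_singleSourceB (φ3 L) ss_t3_x1 (vanish_erase L hbj hb) heq
  have h2 : b 2 = 0 := by
    simp [Fin.prod_univ_four] at hprod
    exact hprod
  funext i
  fin_cases i
  · exact hbj
  · exact hb 1 (by decide)
  · exact h2
  · exact hb 3 (by decide)

/-- The origin reply at `t0` (`V(x₁,x₄)`, `x₁`-chart) lands on `t1`, over `L`. [OURS · ‖ K] -/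
theorem step_origin_t0_allFields [DecidableEq L] :
    CentreBlowup.step 3 {0, 3} 0 (0 : Fin 4 → L) (liftState L t0.toState) = liftState L t1.toState := by
  have h := (step_eq_iff 3 {0, 3} 0 (0 : Fin 4 → ZMod 3) t0 t1).mpr (by decide +kernel)
  rw [liftState, step_baseChange_zero (φ3 L) 3 {0, 3} 0 t0.toState, h]
  rfl

/-- The origin reply at `t3` (`V(x₁,x₃)`, `x₁`-chart) lands on `t4`, over `L`. [OURS · ‖ K] -/
theorem step_origin_t3_allFields [DecidableEq L] :
    CentreBlowup.step 3 {0, 2} 0 (0 : Fin 4 → L) (liftState L t3.toState) = liftState L t4.toState := by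
  have h := (step_eq_iff 3 {0, 2} 0 (0 : Fin 4 → ZMod 3) t3 t4).mpr (by decide +kernel)
  rw [liftState, step_baseChange_zero (φ3 L) 3 {0, 2} 0 t3.toState, h]
  rfl

/-! ## §3 The local wins over every field of characteristic 3 -/

/-- legality of a maximal-dimensional component move at a lifted LOOP-C state: scope goes up, permissibility is
invariant. OURS. [folklore] -/
theorem legal_lift {s : SData 4 (ZMod 3)} (hscope : InCoordinateScope 3 s.toState.F) {S : Finset (Fin 4)}
    (hperm : permB 3 S s.L = true) :
    InCoordinateScope 3 (liftState L s.toState).F ∧ IsPermissibleCentre 3 S (liftState L s.toState).F :=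
  ⟨ScopeBaseChange.inCoordinateScope_map (φ3 L) hscope,
    (BaseChange.isPermissibleCentre_map_iff (φ3 L) 3 S s.toState.F).mpr ((isPermissibleCentre_iff 3 S s.L).mpr hperm)⟩

/-- **`t1` is a local A-win over every field of characteristic 3** (play `V(x₂,x₄)`: no reply). [OURS · ‖ K] -/
theorem rWins_t1_allFields [DecidableEq L] : RWins 3 localB (liftState L t1.toState) :=
  Game.Wins.move (m := ({1, 3} : Finset (Fin 4)))
    (legal_lift L (inCoordinateScope_toState_of_scopeCertB scope_t1) (by decide +kernel))
    fun _ ⟨_, b, hj, hbj, hloc, heq, _, _⟩ =>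
      absurd heq (no_local_reply_t1_allFields L hj hbj ((localB_eq_true_iff _ _ b).mp hloc))

/-- **`t2 = s2` is a local A-win over every field of characteristic 3** (play `V(x₁,x₄)`: no reply). [OURS · ‖ K] -/
theorem rWins_t2_allFields [DecidableEq L] : RWins 3 localB (liftState L t2.toState) :=
  Game.Wins.move (m := ({0, 3} : Finset (Fin 4)))
    (legal_lift L (inCoordinateScope_toState_of_scopeCertB scope_t2) (by decide +kernel))
    fun _ ⟨_, b, hj, hbj, hloc, heq, _, _⟩ =>
      absurd heq (no_local_reply_t2_allFields L hj hbj ((localB_eq_true_iff _ _ b).mp hloc))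

/-- **`t4` is a local A-win over every field of characteristic 3** (play `V(x₂,x₃)`). [OURS · ‖ K] -/
theorem rWins_t4_allFields [DecidableEq L] : RWins 3 localB (liftState L t4.toState) :=
  Game.Wins.move (m := ({1, 2} : Finset (Fin 4)))
    (legal_lift L (inCoordinateScope_toState_of_scopeCertB scope_t4) (by decide +kernel))
    fun _ ⟨_, b, hj, hbj, hloc, heq, _, _⟩ =>
      absurd heq (no_local_reply_t4_allFields L hj hbj ((localB_eq_true_iff _ _ b).mp hloc))

/-- **`t5 = s4` is a local A-win over every field of characteristic 3** (play `V(x₁,x₃)`). [OURS · ‖ K] -/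
theorem rWins_t5_allFields [DecidableEq L] : RWins 3 localB (liftState L t5.toState) :=
  Game.Wins.move (m := ({0, 2} : Finset (Fin 4)))
    (legal_lift L (inCoordinateScope_toState_of_scopeCertB scope_t5) (by decide +kernel))
    fun _ ⟨_, b, hj, hbj, hloc, heq, _, _⟩ =>
      absurd heq (no_local_reply_t5_allFields L hj hbj ((localB_eq_true_iff _ _ b).mp hloc))

/-- **`t0 = s1` is a local A-win over every field of characteristic 3, in two moves**: play `V(x₁,x₄)`; the only
equimultiple `L`-point over the current point is the `x₁`-chart origin, landing on `t1`; there play `V(x₂,x₄)`.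
[OURS · ‖ K] -/
theorem rWins_t0_allFields [DecidableEq L] : RWins 3 localB (liftState L t0.toState) := by
  refine Game.Wins.move (m := ({0, 3} : Finset (Fin 4)))
    (legal_lift L (inCoordinateScope_toState_of_scopeCertB scope_t0) (by decide +kernel)) ?_
  rintro s' ⟨j, b, hj, hbj, hloc, heq, -, rfl⟩
  have hb := (localB_eq_true_iff _ j b).mp hloc
  rcases mem_pair hj with rfl | rfl
  · obtain rfl := local_reply_t0_x1_eq_zero_allFields L hbj hb heq
    rw [step_origin_t0_allFields]
    exact rWins_t1_allFields L
  · exact absurd heq (no_local_reply_t0_x4_allFields L hbj hb)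

/-- **`t3 = s3` is a local A-win over every field of characteristic 3, in two moves** (mirror). [OURS · ‖ K] -/
theorem rWins_t3_allFields [DecidableEq L] : RWins 3 localB (liftState L t3.toState) := by
  refine Game.Wins.move (m := ({0, 2} : Finset (Fin 4)))
    (legal_lift L (inCoordinateScope_toState_of_scopeCertB scope_t3) (by decide +kernel)) ?_
  rintro s' ⟨j, b, hj, hbj, hloc, heq, -, rfl⟩
  have hb := (localB_eq_true_iff _ j b).mp hloc
  rcases mem_pair hj with rfl | rfl
  · obtain rfl := local_reply_t3_x1_eq_zero_allFields L hbj hb heq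
    rw [step_origin_t3_allFields]
    exact rWins_t4_allFields L
  · exact absurd heq (no_local_reply_t3_x3_allFields L hbj hb)

/-- **LOOP-C's LOCAL ESCAPE OVER EVERY FIELD OF CHARACTERISTIC 3**: every state of the LOOP-C region, base-changed to
any field `L` with `CharP L 3`, is an A-win of the LOCAL in-scope game against ALL `L`-rational replies over the
current point. [OURS · ‖ K + symbolic] -/
theorem loopC_localWins_allFields [DecidableEq L] : ∀ s ∈ trapSet loopC, RWins 3 localB (liftState L s) := by
  rintro s ⟨sw, hsw, rfl⟩
  simp only [loopC, List.mem_cons, List.not_mem_nil, or_false] at hsw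
  rcases hsw with rfl | rfl | rfl | rfl | rfl | rfl
  · exact rWins_t0_allFields L
  · exact rWins_t1_allFields L
  · exact rWins_t2_allFields L
  · exact rWins_t3_allFields L
  · exact rWins_t4_allFields L
  · exact rWins_t5_allFields L

end AllFields

end LoopCLocal

end Summit.ResolutionOfSingularities.ResolutionOfSingularities.Theorems.PIDim4

end
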